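import Summits.ABC.IUTFork.Cor312HullGluedPrVolContainerSharp
import HarnessLib

/-!
# [IUTchIII] Cor. 3.12 — the hull-gluing window WITHOUT `hst`: the radii binders are SATISFIABLE (non-vacuity), hence
# the binder-free form `∃ r R ρ, −|log(Θ)| ≤ −|log(Θ)|♮ ≤ −|log(Θ)| + E(r, R, ρ)` at both sharp settings of record

PROOF-ONLY sequel (abc-iut cell, seat abc-iut-w5-d082, WAVE-5; row «HULLGLUED-CONTAINER») of this seat's
`Cor312HullGluedDHVolContainerSharp` / `Cor312HullGluedPrVolContainerSharp`. TAKES NO SIDE on [IUTchIII] Cor. 3.12;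
no definition, no `Prop` fact.

The global windows there take three families of binders at the packets `(i+1, p)`: an inner radius `r_{p,i}` and an
outer radius `R_{p,i}` of the log-shell lattice `ψ(Π_{v⃗} I_{v⃗})` in field-factor coordinates, and a bound `ρ_{p,i}` of
the Θ-idele norms `‖t_{Θ,i+1,v}‖`, `v | p`. THIS FILE discharges them (vacuity audit):

* `exists_idele_norm_bound` — `ρ_{p,i} := 1 + Σ_{v | p} ‖t_{Θ,i+1,v}‖` works (finitely many places over `p`);
* `exists_window_radii` — radii `r`, `R` exist for every packet (abc-iut-c312-5 `exists_ball_subset_latticeF` /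
  `exists_norm_le_of_mem_latticeF`, packaged by abc-iut-w4-d107 `exists_bad_and_radii`), together with `ρ`;
* **`exists_hullGlued_negLogTheta_window_settingDHVolSharp`** / **`exists_hullGlued_negLogTheta_window_settingPrVolSharp`**
  — hence, for the Θ- and q-idele binders of the sharp settings ALONE (`ht0`, `ht1`, `htq0`, `htq1`), there EXIST radii and
  bounds for which `−|log(Θ)| ≤ −|log(Θ)|♮ ≤ −|log(Θ)| + E(r, R, ρ)` with the explicit excess of the parent files.
Reading (neutral): the window theorems are not vacuous; the numerical size of `E` depends on the chosen radii (any
valid choice gives a true bound; the optimal one is the packet's exact log-shell geometry, [IUTchIV] Prop. 1.2/1.4).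
[claim: Mochizuki2012, status: disputed] vocabulary only. [cite: Mochizuki2012, IUTchIV Thm 1.10 proof Step (v) pp. 27–29]
[cite: DupuyHilado2025, §4 (intro), §4.10]
-/

noncomputable section

open Set Function NumberField
open scoped Pointwise

namespace Summit.ABC.IUTFork.Thm311.Real

open Cor312 Cor312.Setting Cor312Vol Literature.IUT.LogThetaLattice Literature.IUT.LogVolume

variable {F : Type} [Field F] [NumberField F] (X : PilotData F) {logv : PadicLogs F} (hlog : LogvAnalytic logv)
  (t : ∀ (pp : Nat.Primes) (_ : Fin X.lstar) (x : (thetaIndex X).Fibre (.inr pp)),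
    haveI : Fact (pp : ℕ).Prime := ⟨pp.2⟩; kOf X pp.1 x)

/-! ## 1. The binders are satisfiable -/

/-- **A bound of the Θ-idele norms over every packet**: `ρ_{p,i} := 1 + Σ_{v | p} ‖t_{Θ,i+1,v}‖ > 0` (finitely many
places of `F` over `p`). [folklore] -/
theorem exists_idele_norm_bound :
    ∃ ρ : Nat.Primes → Fin (thetaIndex X).lstar → ℝ, (∀ pp i, 0 < ρ pp i) ∧
      ∀ (pp : Nat.Primes) (i : Fin (thetaIndex X).lstar) (x : (thetaIndex X).Fibre (.inr pp)),
        haveI : Fact (pp : ℕ).Prime := ⟨pp.2⟩; ‖t pp i x‖ ≤ ρ pp i := by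
  classical
  haveI : ∀ pp : Nat.Primes, Fintype ((thetaIndex X).Fibre (.inr pp)) := fun pp => Fintype.ofFinite _
  refine ⟨fun pp i => haveI : Fact (pp : ℕ).Prime := ⟨pp.2⟩; 1 + ∑ x : (thetaIndex X).Fibre (.inr pp), ‖t pp i x‖,
    fun pp i => ?_, fun pp i x => ?_⟩
  · haveI : Fact (pp : ℕ).Prime := ⟨pp.2⟩
    have h : (0 : ℝ) ≤ ∑ x : (thetaIndex X).Fibre (.inr pp), ‖t pp i x‖ :=
      Finset.sum_nonneg fun x _ => norm_nonneg _
    linarith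
  · haveI : Fact (pp : ℕ).Prime := ⟨pp.2⟩
    have h : ‖t pp i x‖ ≤ ∑ x : (thetaIndex X).Fibre (.inr pp), ‖t pp i x‖ :=
      Finset.single_le_sum (f := fun x => ‖t pp i x‖) (fun x _ => norm_nonneg _) (Finset.mem_univ x)
    linarith

/-- **Sandwich radii of the log-shell lattices and idele-norm bounds EXIST for every packet** (abc-iut-w4-d107
`exists_bad_and_radii`; `exists_idele_norm_bound`). [folklore] -/
theorem exists_window_radii :
    ∃ r R ρ : Nat.Primes → Fin (thetaIndex X).lstar → ℝ,
      (∀ pp i, 0 < r pp i) ∧ (∀ pp i, 0 < R pp i) ∧ (∀ pp i, 0 < ρ pp i) ∧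
      (∀ (pp : Nat.Primes) (i : Fin (thetaIndex X).lstar), haveI : Fact (pp : ℕ).Prime := ⟨pp.2⟩
        ∀ z : (∀ s : (presAt X hlog pp).factorIdx (labelSucc i), (presAt X hlog pp).factorField (labelSucc i) s),
          (∀ s, ‖z s‖ < r pp i) → z ∈ (presAt X hlog pp).latticeF (labelSucc i) 1) ∧
      (∀ (pp : Nat.Primes) (i : Fin (thetaIndex X).lstar), haveI : Fact (pp : ℕ).Prime := ⟨pp.2⟩
        ∀ z ∈ (presAt X hlog pp).latticeF (labelSucc i) 1, ∀ s, ‖z s‖ ≤ R pp i) ∧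
      (∀ (pp : Nat.Primes) (i : Fin (thetaIndex X).lstar) (x : (thetaIndex X).Fibre (.inr pp)),
        haveI : Fact (pp : ℕ).Prime := ⟨pp.2⟩; ‖t pp i x‖ ≤ ρ pp i) := by
  obtain ⟨-, r, R, -, -, -, hr, hR, hball, hbdd⟩ := exists_bad_and_radii X hlog
  obtain ⟨ρ, hρ, hΘ⟩ := exists_idele_norm_bound X t
  exact ⟨r, R, ρ, hr, hR, hρ, hball, hbdd, hΘ⟩

/-! ## 2. The binder-free windows at the two sharp settings of record -/

variable (tq : ∀ (pp : Nat.Primes) (x : (thetaIndex X).Fibre (.inr pp)),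
    haveI : Fact (pp : ℕ).Prime := ⟨pp.2⟩; kOf X pp.1 x)
  (M : Type) [Field M] [NumberField M]
  (archPk : ∀ (j : (thetaIndex X).Label) (vQ : (thetaIndex X).VQ), Set ((logShellsDH X logv).Packet j vQ))
  (archSub : ∀ (j : (thetaIndex X).Label) (v : (thetaIndex X).V),
    Set ((logShellsDH X logv).Packet j ((thetaIndex X).over v)))
  (Ψ : ℤ → ∀ v : (thetaIndex X).V, v ∈ (thetaIndex X).Vbad → Set ((logShellsDH X logv).StarPacket v))
  (act : ℤ → ∀ v : (thetaIndex X).V, v ∈ (thetaIndex X).Vbad →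
    (logShellsDH X logv).StarPacket v → Module.End ℚ ((logShellsDH X logv).StarPacket v))
  (Mmod : ℤ → ∀ j : (thetaIndex X).LabelStar, Set ((logShellsDH X logv).GlobalPacket j.1))
  (region : ℤ → ∀ j : (thetaIndex X).LabelStar, FinDivisor M → ∀ vQ : (thetaIndex X).VQ,
    Set ((logShellsDH X logv).Packet j.1 vQ))
  (n : ℤ) {HT : Type} {LogLink : HT → HT → Type} {IsFull : ∀ {s t : HT}, LogLink s t → Prop}
  (lat : LGPGaussianLogThetaLattice LogLink IsFull)
  {Frd : Type} {IsoF : Frd → Frd → Type} {Ob : Frd → Type} {realify : Frd → Frd} {Strip : Type}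
  {IsoS : Strip → Strip → Type} {Mv : ∀ v : (thetaIndex X).V, v ∈ (thetaIndex X).Vbad → Type}
  [∀ v h, Monoid (Mv v h)]
  (sig : GlobalLGPFrobenioidSignature (thetaIndex X).lstar (thetaIndex X).V (· ∈ (thetaIndex X).Vbad)
    Frd IsoF Ob realify Strip IsoS Mv)
  (split : SplittingMonoids Mv) {ObΔ : Type} {N : ∀ v : (thetaIndex X).V, v ∈ (thetaIndex X).Vbad → Type}
  [∀ v h, Monoid (N v h)] (qData : QPilotData ObΔ N)
  (ht0 : ∀ pp i x, t pp i x ≠ 0)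
  (ht1 : ∀ (pp : Nat.Primes) (i : Fin X.lstar) (x : (thetaIndex X).Fibre (.inr pp)),
    haveI : Fact (pp : ℕ).Prime := ⟨pp.2⟩; placeOf X pp.1 x ∉ X.S → ‖t pp i x‖ = 1)
  (htq0 : ∀ pp x, tq pp x ≠ 0)
  (htq1 : ∀ (pp : Nat.Primes) (x : (thetaIndex X).Fibre (.inr pp)),
    haveI : Fact (pp : ℕ).Prime := ⟨pp.2⟩; placeOf X pp.1 x ∉ X.S → ‖tq pp x‖ = 1)

include ht0 ht1 in
open scoped Classical in
/-- **The binder-free window at `Real.settingDHVolSharp`**: from the idele binders ALONE there exist radii `r`, `R` and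
bounds `ρ` (§1) with `−|log(Θ)| ≤ −|log(Θ)|♮ ≤ −|log(Θ)| + E(r, R, ρ)`, `E` the explicit excess of
`hullGlued_negLogTheta_window_settingDHVolSharp` — the window theorem is NOT vacuous. [claim: Mochizuki2012, status: disputed]
[cite: Mochizuki2012, IUTchIV Thm 1.10 proof Step (v) pp. 27–29] -/
theorem exists_hullGlued_negLogTheta_window_settingDHVolSharp :
    ∃ r R ρ : Nat.Primes → Fin (thetaIndex X).lstar → ℝ,
      (∀ pp i, 0 < r pp i) ∧ (∀ pp i, 0 < R pp i) ∧ (∀ pp i, 0 < ρ pp i) ∧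
      (∀ (pp : Nat.Primes) (i : Fin (thetaIndex X).lstar) (x : (thetaIndex X).Fibre (.inr pp)),
        haveI : Fact (pp : ℕ).Prime := ⟨pp.2⟩; ‖t pp i x‖ ≤ ρ pp i) ∧
      (settingDHVolSharp X hlog M archPk archSub Ψ act Mmod region n lat sig split qData tq t htq0 htq1).negLogTheta ≤
        (settingDHVolSharp X hlog M archPk archSub Ψ act Mmod region n lat sig split qData tq t htq0
          htq1).hullGlued.negLogTheta ∧
      (settingDHVolSharp X hlog M archPk archSub Ψ act Mmod region n lat sig split qData tq t htq0
          htq1).hullGlued.negLogTheta ≤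
        (settingDHVolSharp X hlog M archPk archSub Ψ act Mmod region n lat sig split qData tq t htq0 htq1).negLogTheta +
          ((processionNormalized fun i : Fin (thetaIndex X).lstar => ∑ᶠ vQ : (thetaIndex X).VQ,
            (match vQ with
              | .inl _ => (0 : ℝ)
              | .inr pp => haveI : Fact (pp : ℕ).Prime := ⟨pp.2⟩
                  if (pp : ℕ) ∣ 2 * (NumberField.discr F).natAbs then
                    (∑ e : (presAt X hlog pp).toLocalPieces.E (labelSucc i), (presAt X hlog pp).w (labelSucc i) e) *
                        Real.log (((pp : ℕ) : ℝ) ^ 4 * R pp i ^ 2 * ρ pp i / r pp i ^ 2) -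
                      ((settingDHVolSharp X hlog M archPk archSub Ψ act Mmod region n lat sig split qData tq t htq0
                        htq1).thetaLocal (labelSucc i) (.inr pp)).untopD 0
                  else 0) : ℝ) : WithTop ℝ) := by
  obtain ⟨r, R, ρ, hr, hR, hρ, hball, hbdd, hΘ⟩ := exists_window_radii X hlog t
  exact ⟨r, R, ρ, hr, hR, hρ, hΘ, hullGlued_negLogTheta_window_settingDHVolSharp X hlog t tq M archPk archSub Ψ act Mmod
    region n lat sig split qData ht0 ht1 htq0 htq1 r R ρ hr hR hρ hball hbdd hΘ⟩

include ht0 ht1 in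
open scoped Classical in
/-- **The binder-free window at `Real.settingPrVolSharp`** (print-normalised; the certificate setting): radii and bounds
exist with `−|log(Θ)| ≤ −|log(Θ)|♮ ≤ −|log(Θ)| + E(r, R, ρ)`, `E` the explicit excess of
`hullGlued_negLogTheta_window_settingPrVolSharp`. [claim: Mochizuki2012, status: disputed]
[cite: Mochizuki2012, IUTchIV Thm 1.10 proof Step (v) pp. 27–29] -/
theorem exists_hullGlued_negLogTheta_window_settingPrVolSharp :
    ∃ r R ρ : Nat.Primes → Fin (thetaIndex X).lstar → ℝ,
      (∀ pp i, 0 < r pp i) ∧ (∀ pp i, 0 < R pp i) ∧ (∀ pp i, 0 < ρ pp i) ∧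
      (∀ (pp : Nat.Primes) (i : Fin (thetaIndex X).lstar) (x : (thetaIndex X).Fibre (.inr pp)),
        haveI : Fact (pp : ℕ).Prime := ⟨pp.2⟩; ‖t pp i x‖ ≤ ρ pp i) ∧
      (settingPrVolSharp X hlog M archPk archSub Ψ act Mmod region n lat sig split qData tq t htq0 htq1).negLogTheta ≤
        (settingPrVolSharp X hlog M archPk archSub Ψ act Mmod region n lat sig split qData tq t htq0
          htq1).hullGlued.negLogTheta ∧
      (settingPrVolSharp X hlog M archPk archSub Ψ act Mmod region n lat sig split qData tq t htq0
          htq1).hullGlued.negLogTheta ≤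
        (settingPrVolSharp X hlog M archPk archSub Ψ act Mmod region n lat sig split qData tq t htq0 htq1).negLogTheta +
          ((processionNormalized fun i : Fin (thetaIndex X).lstar => ∑ᶠ vQ : (thetaIndex X).VQ,
            (match vQ with
              | .inl _ => (0 : ℝ)
              | .inr pp =>
                  if (pp : ℕ) ∣ 2 * (NumberField.discr F).natAbs then
                    Real.log (((pp : ℕ) : ℝ) ^ 4 * R pp i ^ 2 * ρ pp i / r pp i ^ 2) -
                      ((settingPrVolSharp X hlog M archPk archSub Ψ act Mmod region n lat sig split qData tq t htq0
                        htq1).thetaLocal (labelSucc i) (.inr pp)).untopD 0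
                  else 0) : ℝ) : WithTop ℝ) := by
  obtain ⟨r, R, ρ, hr, hR, hρ, hball, hbdd, hΘ⟩ := exists_window_radii X hlog t
  exact ⟨r, R, ρ, hr, hR, hρ, hΘ, hullGlued_negLogTheta_window_settingPrVolSharp X hlog t tq M archPk archSub Ψ act Mmod
    region n lat sig split qData ht0 ht1 htq0 htq1 r R ρ hr hR hρ hball hbdd hΘ⟩

end Summit.ABC.IUTFork.Thm311.Real

end
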